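import Literature.NumberTheory.ConnesConsani2021.ProlateSincOperator
import Mathlib.Analysis.ODE.Gronwall
import Mathlib.Analysis.Calculus.Deriv.Shift
import HarnessLib

/-!
# Identification of even solutions of the prolate equation with the tree prolate functions
# (a step of the discharge of `CC2021_sec4_xi_complete`, cell rh-crit row O10)

LINE 1 — FRAMING: RH-FREE classical analysis (Slepian–Pollak 1961 §III, the Sturm–Liouville side of the
prolate spheroidal wave functions); cell rh-crit, corpus C1, seat t10 (lead R66 (4)); bears_on: W-C/W-P
(apex (A), K1 via `CC2021_sec4_xi_complete`).  WHAT THIS IS NOT: any claim about RH — nothing here bears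
on the truth of RH.

Topic `NumberTheory/ConnesConsani2021`; namespace `Literature.NumberTheory.ConnesConsani2021`.  Theorems only.

* `eq_zero_of_prolateODE_of_init` — **Cauchy uniqueness at the regular point `0`** for
  `(λ²−x²)g″ = 2xg′ + ((2πλx)²−χ)g` on `(−λ,λ)`: `g(0) = g′(0) = 0 ⇒ g ≡ 0` (Grönwall on `[−μ,μ]`, `μ < λ`;
  the argument of the tree's `IsProlateFunction.eq_mul_of_ode`, freed of the reference prolate function).
* **`exists_eq_mul_prolateFun_of_even_ode_solution`** — a real, even, `C²` solution `u` of the prolate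
  equation (`λ = 1`, `c = 2π`, eigenvalue arbitrary) with finitely many zeros in `(−1,1)` and `u ≢ 0` on
  `[−1,1]` is `c · prolateFun n` on `[−1,1]` for some `n` and `c ≠ 0`: `u(0) ≠ 0` by the uniqueness lemma
  and evenness; the zeros pair off under `x ↦ −x` (so there are `2n` of them); the normalised
  `1_{[−1,1]}·sign(u(0))·u/‖u‖₂` is an `IsProlateFunction 1 (2n)` (tree structure, all eight fields checked),
  hence `= prolateFun n` by the tree's uniqueness theorem `eq_prolateFun_of_isProlateFunction`
  (`existsUnique_isProlateFunction_holds`).  Consumed by module (b) `ProlateCommutation` (seat t3) together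
  with `ProlateSincOperator`'s `exists_entire_even_repr_of_sincOp_eq_smul` / `re_im_of_entire_eigenfunction`
  (which supply the finiteness of zeros and the real/imaginary splitting of eigenvectors of `𝒫₁𝒫̂₁𝒫₁`);
* `eq_smul_prolateXiI_of_ae_eq`, `mem_span_prolateXiI_of_ae_eq` — back to `L²([−1,1])`: an element a.e.
  equal to `c · prolateFun n` is `c • prolateXiI n ∈ span {prolateXiI n}`;
* **`mem_span_prolateXiI_of_entire_witness`** — ONE-CALL assembly for module (b): from the entire witness
  `G` of an even eigenvector (`exists_entire_even_repr_of_sincOp_eq_smul`) plus the prolate ODE for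
  `Re G|_ℝ` and `Im G|_ℝ` on `(−1,1)` (the joint-eigenvector input), conclude `S ∈ span {prolateXiI n}`.

## References

* D. Slepian, H. O. Pollak, *Prolate spheroidal wave functions, Fourier analysis and uncertainty — I*,
  Bell System Tech. J. 40 (1961) 43–63, §III. [SlepianPollak1961]
* E. A. Coddington, N. Levinson, *Theory of Ordinary Differential Equations* (1955), Ch. 1 §7.
  [CoddingtonLevinson1955]
* A. Connes, C. Consani, *Weil positivity and trace formula, the archimedean place*, Selecta Math. 27
  (2021), §4 p. 16 eq. (prolateeq) (arXiv:2006.13771 p0016:L17–L28). [ConnesConsani2021]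
-/

noncomputable section

open MeasureTheory Complex Set Filter
open scoped Real Topology

namespace Literature.NumberTheory.ConnesConsani2021

open Literature.NumberTheory.LFunctions

/-- **Cauchy uniqueness at the regular point `0`** for the prolate equation
`(λ² − x²)g″ = 2xg′ + ((2πλx)² − χ)g` on `(−λ, λ)`: `g(0) = g′(0) = 0 ⇒ g ≡ 0` (Grönwall on `[−μ, μ]`,
`μ < λ`, as in the tree's `IsProlateFunction.eq_mul_of_ode`). [cite: CoddingtonLevinson1955, Ch. 1 §7; SlepianPollak1961, §III] -/
theorem eq_zero_of_prolateODE_of_init {lam χ : ℝ} (hlam : 0 < lam) {g g₁ g₂ : ℝ → ℝ}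
    (hg : ∀ x ∈ Ioo (-lam) lam, HasDerivAt g (g₁ x) x)
    (hg₁ : ∀ x ∈ Ioo (-lam) lam, HasDerivAt g₁ (g₂ x) x)
    (hode : ∀ x ∈ Ioo (-lam) lam,
      (lam ^ 2 - x ^ 2) * g₂ x = 2 * x * g₁ x + ((2 * π * lam * x) ^ 2 - χ) * g x)
    (hg0 : g 0 = 0) (hg₁0 : g₁ 0 = 0) : ∀ x ∈ Ioo (-lam) lam, g x = 0 := by
  intro x hx
  set μ : ℝ := (|x| + lam) / 2 with hμ
  have hxabs : |x| < lam := abs_lt.mpr ⟨hx.1, hx.2⟩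
  have hμlam : μ < lam := by rw [hμ]; linarith
  have hμpos : 0 < μ := by rw [hμ]; linarith [abs_nonneg x]
  have hxμ : x ∈ Ioo (-μ) μ := by
    rw [hμ]; constructor <;> cases abs_lt.mp (show |x| < (|x| + lam) / 2 by linarith) <;> linarith
  have hsub : Ioo (-μ) μ ⊆ Ioo (-lam) lam := Ioo_subset_Ioo (by linarith) hμlam.le
  let v : ℝ → ℝ × ℝ → ℝ × ℝ := fun t Y ↦
    (Y.2, (2 * t * Y.2 + ((2 * π * lam * t) ^ 2 - χ) * Y.1) / (lam ^ 2 - t ^ 2))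
  set L : ℝ := (2 * lam + ((2 * π * lam * lam) ^ 2 + |χ|)) / (lam ^ 2 - μ ^ 2) + 1 with hL
  have hden : 0 < lam ^ 2 - μ ^ 2 := by nlinarith
  have hLpos : 0 < L := by rw [hL]; positivity
  have hv : ∀ t ∈ Ioo (-μ) μ, LipschitzOnWith (Real.toNNReal L) (v t) univ := by
    intro t ht
    have htabs : |t| < μ := abs_lt.mpr ⟨ht.1, ht.2⟩
    have hpt : lam ^ 2 - μ ^ 2 ≤ lam ^ 2 - t ^ 2 := by nlinarith [abs_nonneg t, sq_abs t]
    have hpt0 : 0 < lam ^ 2 - t ^ 2 := lt_of_lt_of_le hden hpt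
    refine (LipschitzWith.of_dist_le_mul fun Y Z ↦ ?_).lipschitzOnWith
    rw [Real.coe_toNNReal _ hLpos.le]
    have hd1 : dist Y.1 Z.1 ≤ dist Y Z := by rw [Prod.dist_eq]; exact le_max_left _ _
    have hd2 : dist Y.2 Z.2 ≤ dist Y Z := by rw [Prod.dist_eq]; exact le_max_right _ _
    rw [Real.dist_eq] at hd1 hd2
    have hdYZ : 0 ≤ dist Y Z := dist_nonneg
    rw [Prod.dist_eq]
    refine max_le ?_ ?_
    · rw [Real.dist_eq]
      calc |Y.2 - Z.2| ≤ dist Y Z := hd2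
        _ = 1 * dist Y Z := (one_mul _).symm
        _ ≤ L * dist Y Z := by
            gcongr; rw [hL]
            linarith [show 0 ≤ (2 * lam + ((2 * π * lam * lam) ^ 2 + |χ|)) / (lam ^ 2 - μ ^ 2) by
              positivity]
    · rw [Real.dist_eq, ← sub_div, abs_div, abs_of_pos hpt0]
      have hcoef1 : |2 * t| ≤ 2 * lam := by rw [abs_mul, abs_two]; linarith
      have hcoef2 : |(2 * π * lam * t) ^ 2 - χ| ≤ (2 * π * lam * lam) ^ 2 + |χ| := by
        refine (abs_sub _ _).trans (add_le_add ?_ le_rfl)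
        rw [abs_pow, pow_le_pow_iff_left₀ (abs_nonneg _) (by positivity) two_ne_zero, abs_mul,
          abs_of_pos (by positivity : 0 < 2 * π * lam)]
        exact mul_le_mul_of_nonneg_left (by linarith) (by positivity)
      have hnum : |2 * t * Y.2 + ((2 * π * lam * t) ^ 2 - χ) * Y.1
            - (2 * t * Z.2 + ((2 * π * lam * t) ^ 2 - χ) * Z.1)|
          ≤ (2 * lam + ((2 * π * lam * lam) ^ 2 + |χ|)) * dist Y Z := by
        have e : 2 * t * Y.2 + ((2 * π * lam * t) ^ 2 - χ) * Y.1
            - (2 * t * Z.2 + ((2 * π * lam * t) ^ 2 - χ) * Z.1)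
            = 2 * t * (Y.2 - Z.2) + ((2 * π * lam * t) ^ 2 - χ) * (Y.1 - Z.1) := by ring
        rw [e]
        refine (abs_add_le _ _).trans ?_
        rw [abs_mul (2 * t), abs_mul ((2 * π * lam * t) ^ 2 - χ), add_mul]
        exact add_le_add (mul_le_mul hcoef1 hd2 (abs_nonneg _) (by linarith))
          (mul_le_mul hcoef2 hd1 (abs_nonneg _) (by positivity))
      calc |2 * t * Y.2 + ((2 * π * lam * t) ^ 2 - χ) * Y.1
              - (2 * t * Z.2 + ((2 * π * lam * t) ^ 2 - χ) * Z.1)| / (lam ^ 2 - t ^ 2)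
          ≤ (2 * lam + ((2 * π * lam * lam) ^ 2 + |χ|)) * dist Y Z / (lam ^ 2 - μ ^ 2) := by
            gcongr
        _ = ((2 * lam + ((2 * π * lam * lam) ^ 2 + |χ|)) / (lam ^ 2 - μ ^ 2)) * dist Y Z := by
            ring
        _ ≤ L * dist Y Z := by gcongr; rw [hL]; linarith
  have hY : ∀ t ∈ Ioo (-μ) μ,
      HasDerivAt (fun s ↦ (g s, g₁ s)) (v t (g t, g₁ t)) t ∧ (g t, g₁ t) ∈ univ := by
    intro t ht
    have ht' := hsub ht
    have hpt0 : lam ^ 2 - t ^ 2 ≠ 0 := by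
      have : |t| < lam := abs_lt.mpr ⟨ht'.1, ht'.2⟩; nlinarith [abs_nonneg t, sq_abs t]
    refine ⟨?_, mem_univ _⟩
    have hd := (hg t ht').prodMk (hg₁ t ht')
    convert hd using 2
    rw [div_eq_iff hpt0]
    have e1 := hode t ht'
    linear_combination -e1
  have hZ : ∀ t ∈ Ioo (-μ) μ,
      HasDerivAt (fun _ : ℝ ↦ ((0 : ℝ), (0 : ℝ))) (v t ((0 : ℝ), (0 : ℝ))) t
        ∧ ((0 : ℝ), (0 : ℝ)) ∈ univ := by
    intro t ht
    refine ⟨?_, mem_univ _⟩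
    have : v t ((0 : ℝ), (0 : ℝ)) = ((0 : ℝ), (0 : ℝ)) := by
      simp only [v, mul_zero, add_zero, zero_div]
    rw [this]
    exact hasDerivAt_const t _
  have h0μ : (0 : ℝ) ∈ Ioo (-μ) μ := ⟨by linarith, hμpos⟩
  have heq : (fun s ↦ (g s, g₁ s)) 0 = (fun _ : ℝ ↦ ((0 : ℝ), (0 : ℝ))) 0 := by
    simp only [hg0, hg₁0]
  have hE := ODE_solution_unique_of_mem_Ioo hv h0μ hY hZ heq hxμ
  have := congrArg Prod.fst hE
  simpa using this

/-- **Identification of even solutions with the tree prolate functions**: a real, even, `C²` function `u`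
solving the prolate equation `−((1−x²)u′)′ + (2πx)²u = χu` on `(−1,1)` for some `χ`, with finitely many
zeros in `(−1,1)` and not identically zero on `[−1,1]`, is a non-zero multiple of `prolateFun n` on `[−1,1]`
for some `n` (Cauchy uniqueness at `0` gives `u(0) ≠ 0`; the zeros pair off under `x ↦ −x`, so their number
is even, `= 2n`; the normalised `1_{[−1,1]}·u/‖u‖·sign u(0)` is an `IsProlateFunction 1 (2n)`, hence equals
`prolateFun n` by the tree's uniqueness `eq_prolateFun_of_isProlateFunction`).  The zero-count /
identification step of Slepian–Pollak §III for the EVEN sector. [cite: SlepianPollak1961, §III; ConnesConsani2021, §4 p. 16 eq. (prolateeq) (arXiv p0016:L17–L28)] -/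
theorem exists_eq_mul_prolateFun_of_even_ode_solution {u : ℝ → ℝ} (hu : ContDiff ℝ 2 u)
    (heven : ∀ x, u (-x) = u x)
    (hode : ∃ χ : ℝ, ∀ x ∈ Ioo (-1 : ℝ) 1,
      -(deriv (fun y ↦ (1 ^ 2 - y ^ 2) * deriv u y) x) + (2 * π * 1 * x) ^ 2 * u x = χ * u x)
    (hfin : {x : ℝ | x ∈ Ioo (-1 : ℝ) 1 ∧ u x = 0}.Finite)
    (hne : ∃ x ∈ Icc (-1 : ℝ) 1, u x ≠ 0) :
    ∃ (n : ℕ) (c : ℝ), c ≠ 0 ∧ ∀ x ∈ Icc (-1 : ℝ) 1, u x = c * prolateFun n x := by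
  obtain ⟨χ, hχ⟩ := hode
  -- derivatives of `u`
  have hd : Differentiable ℝ u := hu.differentiable (by norm_num)
  have hu1 : ContDiff ℝ 1 (deriv u) := by
    have h := (contDiff_succ_iff_deriv (n := 1) (f := u)).1 (by simpa [one_add_one_eq_two] using hu)
    exact h.2.2
  have hd' : Differentiable ℝ (deriv u) := hu1.differentiable one_ne_zero
  have hprod : ∀ x : ℝ, deriv (fun y ↦ (1 ^ 2 - y ^ 2) * deriv u y) x =
      -(2 * x) * deriv u x + (1 ^ 2 - x ^ 2) * deriv (deriv u) x := by
    intro x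
    have h1 : HasDerivAt (fun y : ℝ => (1 : ℝ) ^ 2 - y ^ 2) (-(2 * x)) x := by
      have h := (hasDerivAt_pow 2 x).const_sub ((1 : ℝ) ^ 2)
      simp only [Nat.cast_ofNat, Nat.add_one_sub_one, pow_one] at h
      exact h
    exact (h1.mul (hd' x).hasDerivAt).deriv
  have hode' : ∀ x ∈ Ioo (-1 : ℝ) 1, ((1 : ℝ) ^ 2 - x ^ 2) * deriv (deriv u) x =
      2 * x * deriv u x + ((2 * π * 1 * x) ^ 2 - χ) * u x := by
    intro x hx
    have h := hχ x hx
    rw [hprod] at h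
    linarith
  -- `u 0 ≠ 0` (Cauchy uniqueness at the regular point `0`, `u′(0) = 0` by evenness)
  have hd0 : deriv u 0 = 0 := by
    have h1 : deriv (fun x => u (-x)) 0 = -deriv u (-0) := deriv_comp_neg u 0
    have h2 : (fun x => u (-x)) = u := funext heven
    rw [h2, neg_zero] at h1
    linarith
  have hu0 : u 0 ≠ 0 := by
    intro h0
    have hz := eq_zero_of_prolateODE_of_init one_pos (χ := χ) (g := u) (g₁ := deriv u)
      (g₂ := deriv (deriv u)) (fun x _ => (hd x).hasDerivAt) (fun x _ => (hd' x).hasDerivAt)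
      hode' h0 hd0
    obtain ⟨x₀, hx₀, hne₀⟩ := hne
    apply hne₀
    have hcl : Icc (-1 : ℝ) 1 ⊆ closure (Ioo (-1 : ℝ) 1) := by rw [closure_Ioo (by norm_num)]
    have hEq : EqOn u 0 (Icc (-1 : ℝ) 1) :=
      (show EqOn u 0 (Ioo (-1 : ℝ) 1) from hz).of_subset_closure hu.continuous.continuousOn
        continuousOn_const Ioo_subset_Icc_self hcl
    exact hEq hx₀
  -- the zeros pair off under `x ↦ -x`: their number is even
  set Zp : Set ℝ := {x : ℝ | x ∈ Ioo (0 : ℝ) 1 ∧ u x = 0} with hZp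
  set Zm : Set ℝ := {x : ℝ | x ∈ Ioo (-1 : ℝ) 0 ∧ u x = 0} with hZm
  have hZsplit : {x : ℝ | x ∈ Ioo (-1 : ℝ) 1 ∧ u x = 0} = Zm ∪ Zp := by
    ext x
    simp only [mem_setOf_eq, mem_union, mem_Ioo, hZm, hZp]
    constructor
    · rintro ⟨⟨h1, h2⟩, h3⟩
      rcases lt_trichotomy x 0 with h | h | h
      · exact Or.inl ⟨⟨h1, h⟩, h3⟩
      · exact absurd (h ▸ h3) hu0
      · exact Or.inr ⟨⟨h, h2⟩, h3⟩
    · rintro (⟨⟨h1, h2⟩, h3⟩ | ⟨⟨h1, h2⟩, h3⟩)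
      · exact ⟨⟨h1, by linarith⟩, h3⟩
      · exact ⟨⟨by linarith, h2⟩, h3⟩
  have hZm_eq : Zm = (fun x : ℝ => -x) '' Zp := by
    ext x
    simp only [mem_setOf_eq, mem_image, mem_Ioo, hZm, hZp]
    constructor
    · rintro ⟨⟨h1, h2⟩, h3⟩
      exact ⟨-x, ⟨⟨by linarith, by linarith⟩, by rw [heven]; exact h3⟩, neg_neg x⟩
    · rintro ⟨y, ⟨⟨h1, h2⟩, h3⟩, rfl⟩
      exact ⟨⟨by linarith, by linarith⟩, by rw [heven]; exact h3⟩
  have hZp_fin : Zp.Finite := hfin.subset (by rw [hZsplit]; exact subset_union_right)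
  have hZm_fin : Zm.Finite := hfin.subset (by rw [hZsplit]; exact subset_union_left)
  have hdisj : Disjoint Zm Zp := by
    rw [Set.disjoint_left]
    rintro x ⟨⟨-, h2⟩, -⟩ ⟨⟨h3, -⟩, -⟩
    linarith
  set m : ℕ := Zp.ncard with hm
  have hcard : {x : ℝ | x ∈ Ioo (-1 : ℝ) 1 ∧ u x = 0}.ncard = 2 * m := by
    rw [hZsplit, Set.ncard_union_eq hdisj hZm_fin hZp_fin, hZm_eq,
      Set.ncard_image_of_injective _ neg_injective, hm]
    ring
  -- normalisation: `N = ∫_{-1}^{1} u² > 0`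
  set N : ℝ := ∫ x in (-1 : ℝ)..1, u x ^ 2 with hN
  have hcont2 : Continuous fun x => u x ^ 2 := hu.continuous.pow 2
  have hNpos : 0 < N := by
    obtain ⟨ε, hε, hball⟩ := Metric.eventually_nhds_iff.1
      ((hu.continuous.continuousAt (x := (0 : ℝ))).eventually_ne hu0)
    set δ : ℝ := min (ε / 2) (1 / 2) with hδ
    have hδpos : 0 < δ := by rw [hδ]; exact lt_min (by linarith) (by norm_num)
    have hδε : δ < ε := lt_of_le_of_lt (min_le_left _ _) (by linarith)
    have hδ1 : δ ≤ 1 := (min_le_right _ _).trans (by norm_num)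
    have h1 : 0 < ∫ x in (-δ)..δ, u x ^ 2 := by
      refine intervalIntegral.intervalIntegral_pos_of_pos_on (hcont2.intervalIntegrable _ _)
        (fun x hx => ?_) (by linarith)
      have hx' : dist x 0 < ε := by
        rw [Real.dist_eq, sub_zero]; exact (abs_lt.2 ⟨hx.1, hx.2⟩).trans hδε
      have hux : u x ≠ 0 := hball hx'
      positivity
    have h2 : (∫ x in (-δ)..δ, u x ^ 2) ≤ N :=
      intervalIntegral.integral_mono_interval (by linarith) (by linarith) hδ1
        (Eventually.of_forall fun x => sq_nonneg (u x)) (hcont2.intervalIntegrable _ _)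
    linarith
  -- the normalised function `f = 1_{[-1,1]} · s · u`, `s = sign(u 0)/√N`
  set σ : ℝ := if 0 < u 0 then 1 else -1 with hσ
  have hσsq : σ ^ 2 = 1 := by rw [hσ]; split_ifs <;> norm_num
  have hσu : 0 < σ * u 0 := by
    rw [hσ]; split_ifs with h
    · rw [one_mul]; exact h
    · have : u 0 < 0 := lt_of_le_of_ne (not_lt.1 h) hu0
      linarith
  set s : ℝ := σ / Real.sqrt N with hs
  have hsqrt : 0 < Real.sqrt N := Real.sqrt_pos.2 hNpos
  have hs2 : s ^ 2 * N = 1 := by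
    rw [hs, div_pow, hσsq, Real.sq_sqrt hNpos.le]
    field_simp
  have hs0 : s ≠ 0 := by
    intro h; rw [h] at hs2; simp at hs2
  set f : ℝ → ℝ := (Icc (-1 : ℝ) 1).indicator fun x => s * u x with hf
  have hfI : ∀ x ∈ Icc (-1 : ℝ) 1, f x = s * u x := fun x hx => by rw [hf, indicator_of_mem hx]
  have hfev : ∀ x ∈ Ioo (-1 : ℝ) 1, f =ᶠ[𝓝 x] fun y => s * u y := fun x hx => by
    filter_upwards [isOpen_Ioo.mem_nhds hx] with y hy using hfI y (Ioo_subset_Icc_self hy)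
  have hdf : ∀ x ∈ Ioo (-1 : ℝ) 1, deriv f x = s * deriv u x := fun x hx => by
    rw [(hfev x hx).deriv_eq, deriv_const_mul _ (hd x)]
  -- the zero set of `f` in `(-1, 1)` is that of `u`
  have hfz : {x : ℝ | x ∈ Ioo (-1 : ℝ) 1 ∧ f x = 0} = {x : ℝ | x ∈ Ioo (-1 : ℝ) 1 ∧ u x = 0} := by
    ext x
    simp only [mem_setOf_eq]
    constructor
    · rintro ⟨hx, h⟩
      rw [hfI x (Ioo_subset_Icc_self hx)] at h
      exact ⟨hx, (mul_eq_zero.1 h).resolve_left hs0⟩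
    · rintro ⟨hx, h⟩
      exact ⟨hx, by rw [hfI x (Ioo_subset_Icc_self hx), h, mul_zero]⟩
  have hP : IsProlateFunction 1 (2 * m) f :=
    { lam_pos := one_pos
      contDiffOn := by
        refine (((contDiff_const (c := s)).mul hu).contDiffOn (s := Icc (-1 : ℝ) 1)).congr
          fun x hx => ?_
        exact hfI x hx
      eigen := by
        refine ⟨χ, fun x hx => ?_⟩
        have e1 : (fun y ↦ ((1 : ℝ) ^ 2 - y ^ 2) * deriv f y) =ᶠ[𝓝 x]
            fun y => s * ((1 ^ 2 - y ^ 2) * deriv u y) := by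
          filter_upwards [isOpen_Ioo.mem_nhds hx] with y hy
          rw [hdf y hy]; ring
        rw [e1.deriv_eq, deriv_const_mul_field, hfI x (Ioo_subset_Icc_self hx)]
        have h := hχ x hx
        linear_combination s * h
      support := fun x hx => by
        rw [hf, indicator_of_notMem]
        rw [mem_Icc, not_and_or, not_le, not_le]
        rcases le_or_gt 0 x with h | h
        · right; rwa [abs_of_nonneg h] at hx
        · left; rw [abs_of_neg h] at hx; linarith
      zeros_finite := by rw [hfz]; exact hfin
      zeros_card := by rw [hfz, hcard]
      norm_one := by
        have e1 : ∫ x in (-1 : ℝ)..1, f x ^ 2 = ∫ x in (-1 : ℝ)..1, s ^ 2 * u x ^ 2 := by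
          refine intervalIntegral.integral_congr fun x hx => ?_
          rw [uIcc_of_le (by norm_num : (-1 : ℝ) ≤ 1)] at hx
          rw [hfI x hx]; ring
        rw [e1, intervalIntegral.integral_const_mul]
        exact hs2
      pos_zero := by
        rw [hfI 0 ⟨by norm_num, by norm_num⟩, hs, div_mul_eq_mul_div]
        exact div_pos hσu hsqrt }
  have hfeq : f = prolateFun m := eq_prolateFun_of_isProlateFunction hP
  refine ⟨m, s⁻¹, inv_ne_zero hs0, fun x hx => ?_⟩
  have h := hfI x hx
  rw [hfeq] at h
  rw [h, ← mul_assoc, inv_mul_cancel₀ hs0, one_mul]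

/-- **From functions back to `L²([−1,1])`**: an element of `L²([−1,1])` which is a.e. `c · prolateFun n` IS
`c • prolateXiI n` (so lies in `span {prolateXiI n}`). [cite: ConnesConsani2021, Prop. 4.5 (i) §4 p. 16 (arXiv p0016:L50)] -/
theorem eq_smul_prolateXiI_of_ae_eq {S : Lp ℂ 2 (volume.restrict (Icc (-1 : ℝ) 1))} {c : ℂ} {n : ℕ}
    (h : (S : ℝ → ℂ) =ᵐ[volume.restrict (Icc (-1 : ℝ) 1)] fun x => c * (prolateFun n x : ℂ)) :
    S = c • prolateXiI n := by
  refine Lp.ext ?_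
  have h1 : (prolateXiI n : ℝ → ℂ) =ᵐ[volume.restrict (Icc (-1 : ℝ) 1)] prolateXiFun n :=
    MemLp.coeFn_toLp _
  filter_upwards [h, h1, Lp.coeFn_smul c (prolateXiI n)] with x hx hx1 hx2
  rw [hx2, Pi.smul_apply, hx1, hx, smul_eq_mul]
  rfl

/-- Hence such an element lies in the span of the even prolate functions. [cite: ConnesConsani2021, Prop. 4.5 (i) §4 p. 16 (arXiv p0016:L50)] -/
theorem mem_span_prolateXiI_of_ae_eq {S : Lp ℂ 2 (volume.restrict (Icc (-1 : ℝ) 1))} {c : ℂ} {n : ℕ}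
    (h : (S : ℝ → ℂ) =ᵐ[volume.restrict (Icc (-1 : ℝ) 1)] fun x => c * (prolateFun n x : ℂ)) :
    S ∈ Submodule.span ℂ (Set.range prolateXiI) := by
  rw [eq_smul_prolateXiI_of_ae_eq h]
  exact Submodule.smul_mem _ _ (Submodule.subset_span ⟨n, rfl⟩)

/-! ### One-call assembly for a joint eigenvector: from the entire witness to the span -/

/-- A real part / imaginary part of the entire witness is, on `[−1,1]`, a (possibly zero) multiple of one
prolate function, provided it solves the prolate equation on `(−1,1)`. [cite: SlepianPollak1961, §III] -/
private theorem exists_eq_mul_prolateFun_of_part {u : ℝ → ℝ} (hu : ContDiff ℝ (⊤ : ℕ∞) u)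
    (heven : ∀ x, u (-x) = u x)
    (hode : ∃ χ : ℝ, ∀ x ∈ Ioo (-1 : ℝ) 1,
      -(deriv (fun y ↦ (1 ^ 2 - y ^ 2) * deriv u y) x) + (2 * π * 1 * x) ^ 2 * u x = χ * u x)
    (hz : (∀ x : ℝ, u x = 0) ∨ {x : ℝ | x ∈ Icc (-1 : ℝ) 1 ∧ u x = 0}.Finite) :
    ∃ (n : ℕ) (c : ℝ), ∀ x ∈ Icc (-1 : ℝ) 1, u x = c * prolateFun n x := by
  rcases hz with h0 | hfin
  · exact ⟨0, 0, fun x _ => by rw [h0 x, zero_mul]⟩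
  · have hu2 : ContDiff ℝ 2 u := by
      refine hu.of_le ?_
      change ((2 : ℕ∞) : WithTop ℕ∞) ≤ ((⊤ : ℕ∞) : WithTop ℕ∞)
      exact WithTop.coe_le_coe.2 le_top
    have hne : ∃ x ∈ Icc (-1 : ℝ) 1, u x ≠ 0 := by
      by_contra h
      push Not at h
      have hsub : Icc (-1 : ℝ) 1 ⊆ {x : ℝ | x ∈ Icc (-1 : ℝ) 1 ∧ u x = 0} := fun x hx => ⟨hx, h x hx⟩
      exact ((Icc_infinite (by norm_num : (-1 : ℝ) < 1)).mono hsub) hfin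
    obtain ⟨n, c, -, hc⟩ := exists_eq_mul_prolateFun_of_even_ode_solution hu2 heven hode
      (hfin.subset fun x hx => ⟨Ioo_subset_Icc_self hx.1, hx.2⟩) hne
    exact ⟨n, c, hc⟩

/-- **One-call assembly for module (b)**: if `S ∈ L²([−1,1])` is a.e. the restriction of an entire function
`G` with `G|_ℝ` even, satisfying the sinc eigen-equation `νG(y) = ∫_{−1}^{1}κ(y−x)G(x)dx` on `[−1,1]`
(the witness of `exists_entire_even_repr_of_sincOp_eq_smul`), and the real and imaginary parts of `G|_ℝ`
each solve the prolate equation on `(−1,1)` (for some eigenvalues — the joint-eigenvector input of the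
commutation step), then `S ∈ span {prolateXiI n}`. [cite: SlepianPollak1961, §III; ConnesConsani2021, Prop. 4.5 (i) §4 p. 16] -/
theorem mem_span_prolateXiI_of_entire_witness {S : Lp ℂ 2 (volume.restrict (Icc (-1 : ℝ) 1))}
    {G : ℂ → ℂ} (hGd : Differentiable ℂ G) (hGeven : ∀ y : ℝ, G (-y) = G y)
    (hSG : (S : ℝ → ℂ) =ᵐ[volume.restrict (Icc (-1 : ℝ) 1)] fun x : ℝ => G x) {ν : ℝ}
    (heq : ∀ y ∈ Icc (-1 : ℝ) 1, (ν : ℂ) * G y = ∫ x in Icc (-1 : ℝ) 1, sincKernel (y - x) * G x)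
    (hode_re : ∃ χ : ℝ, ∀ x ∈ Ioo (-1 : ℝ) 1,
      -(deriv (fun y ↦ (1 ^ 2 - y ^ 2) * deriv (fun t : ℝ => (G t).re) y) x) +
        (2 * π * 1 * x) ^ 2 * (G x).re = χ * (G x).re)
    (hode_im : ∃ χ : ℝ, ∀ x ∈ Ioo (-1 : ℝ) 1,
      -(deriv (fun y ↦ (1 ^ 2 - y ^ 2) * deriv (fun t : ℝ => (G t).im) y) x) +
        (2 * π * 1 * x) ^ 2 * (G x).im = χ * (G x).im) :
    S ∈ Submodule.span ℂ (Set.range prolateXiI) := by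
  have hGi : IntegrableOn (fun x : ℝ => G x) (Icc (-1 : ℝ) 1) :=
    (hGd.continuous.comp Complex.continuous_ofReal).continuousOn.integrableOn_compact isCompact_Icc
  obtain ⟨-, -, hcre, hcim, hzre, hzim⟩ := re_im_of_entire_eigenfunction hGd heq hGi
  have hev_re : ∀ x : ℝ, (G (-x : ℝ)).re = (G x).re := fun x => by
    rw [Complex.ofReal_neg, hGeven]
  have hev_im : ∀ x : ℝ, (G (-x : ℝ)).im = (G x).im := fun x => by
    rw [Complex.ofReal_neg, hGeven]
  obtain ⟨n₁, c₁, h₁⟩ := exists_eq_mul_prolateFun_of_part hcre hev_re hode_re hzre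
  obtain ⟨n₂, c₂, h₂⟩ := exists_eq_mul_prolateFun_of_part hcim hev_im hode_im hzim
  -- `S = c₁ • ξ_{n₁} + (I c₂) • ξ_{n₂}` in `L²([-1,1])`
  have hx1 : (prolateXiI n₁ : ℝ → ℂ) =ᵐ[volume.restrict (Icc (-1 : ℝ) 1)] prolateXiFun n₁ :=
    MemLp.coeFn_toLp _
  have hx2 : (prolateXiI n₂ : ℝ → ℂ) =ᵐ[volume.restrict (Icc (-1 : ℝ) 1)] prolateXiFun n₂ :=
    MemLp.coeFn_toLp _
  have hS : S = (c₁ : ℂ) • prolateXiI n₁ + ((c₂ : ℂ) * I) • prolateXiI n₂ := by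
    refine Lp.ext ?_
    filter_upwards [hSG, hx1, hx2, ae_restrict_mem measurableSet_Icc,
      Lp.coeFn_add ((c₁ : ℂ) • prolateXiI n₁) (((c₂ : ℂ) * I) • prolateXiI n₂),
      Lp.coeFn_smul (c₁ : ℂ) (prolateXiI n₁), Lp.coeFn_smul ((c₂ : ℂ) * I) (prolateXiI n₂)]
      with x hx h1 h2 hxI ha hs1 hs2
    rw [ha, Pi.add_apply, hs1, hs2, Pi.smul_apply, Pi.smul_apply, h1, h2, hx, smul_eq_mul, smul_eq_mul]
    show G x = (c₁ : ℂ) * (prolateFun n₁ x : ℂ) + (c₂ : ℂ) * I * (prolateFun n₂ x : ℂ)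
    rw [← Complex.re_add_im (G x), h₁ x hxI, h₂ x hxI]
    push_cast
    ring
  rw [hS]
  exact Submodule.add_mem _ (Submodule.smul_mem _ _ (Submodule.subset_span ⟨n₁, rfl⟩))
    (Submodule.smul_mem _ _ (Submodule.subset_span ⟨n₂, rfl⟩))

end Literature.NumberTheory.ConnesConsani2021
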